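import Summits.BirchSwinnertonDyer.BirchSwinnertonDyer.Theorems.PrintCFramBottomClassIndexLawFiveLeBorelOStructure
import Summits.BirchSwinnertonDyer.BirchSwinnertonDyer.Theorems.PrintCFramBottomClassIndexLawFiveLeBorelNonScalarLeaf
import Literature.NumberTheory.GaloisRepresentations.ArtinFormalismInductionProofs
import HarnessLib

/-!
# Route `PrintCFram`, crux C2 `BottomClassIndexLawFiveLe` (stmt-BirchSwinnertonDyer-20372), line
# `eisenstein-resource-bdp-line` (S2 `stub_kolyvaginUpper_borelCM_pairSum`, input (γ)):
# **`W[p]` is UNISERIAL over every number field of degree `< p`** — the only `Γ_{K''}`-stable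
# subgroups of `W[p]` are `0`, `W[𝔭] = ker √−p`, `W[p]`
# (cell `bsd-print-cfram`, seat `bsd-line-cfram-p1-w2` g5; helper `--supports` 20372; 0 facts, 0 defs)

HONEST FRAMING. Nothing about BSD is proved here, and nothing of S2 itself. This file (8b) proves,
for a CM curve `W/ℚ` at a CM-ramified prime `p ≥ 5` and `μ = √−p ∈ End W(ℚ̄)` with its Galois sign
rule (`exists_sqrt_end_of_cmRamified`), the hypothesis `hS` of the uniserial Prop. 9.3 of
`…BorelGrossSurjectivity` (file 8a): for every number field `K''` with `[K'' : ℚ] < p`, a subgroup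
`H ≤ W[p]` stable under `res Γ_{K''}` is `0`, `ker μ` or `W[p]`. Inputs: the `𝒪`-structure of
`…BorelOStructure` (`W[p] = ℤv + ℤμv`, `#ker μ = p`), the non-scalar Frobenius fixing `√−p` of
`…BorelNonScalarLeaf` (w4 g3, `exists_frobenius_nonScalar_of_cmRamified`: `σ = a + bμ`, `p ∤ ab`),
and `[Γ_ℚ : res Γ_{K''}] = [K'' : ℚ]` (`index_range_absGaloisRestrict_eq_finrank`), whence a power
`σⁿ ∈ res Γ_{K''}`, `0 < n ≤ [K'' : ℚ] < p`, acting as `aⁿ + n aⁿ⁻¹ b μ` — still NON-SCALAR; and a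
subgroup of `A[p]` stable under one non-scalar operator commuting with `μ` is `0`, `ker μ` or `A[p]`
(`eq_bot_or_eq_ker_or_eq_torsionBy`, any abelian group `A`). So uniseriality holds over `ℚ(√−p)`
itself and over the biquadratic `K·K''` of the S2 memo, not only over Heegner fields `K'' ∌ √−p`
(contrast: the scalar commutant of `…BorelScalarCommutant` genuinely needs `√−p ∉ K''`).

* §1 generic (`μ² = m`, `|m| = p`, `#A[p] = p²`, `μ ≠ 0` on `A[p]`): `zsmul_eq_zero_of_natAbs_eq`,
  `exists_eq_zsmul_add_zsmul_of_apply_ne_zero` (any `P` off the line generates `A[p] = ℤP + ℤμP`),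
  `eq_bot_or_eq_ker_or_eq_torsionBy` (the trichotomy), `exists_sub_zsmul_mem_ker` (`A[p]/ker μ`
  cyclic), `pow_smul_eq` (`(a + bμ)ⁿ = aⁿ + n aⁿ⁻¹ b μ` on `A[p]`).
* §2 leaf: `exists_restrict_smul_eq_nonScalar` (`∃ g ∈ Γ_{K''}`, `res g = u + wμ` on `W[p]`,
  `p ∤ w`), `smul_mem_ker_of_mem_ker` (`W[𝔭]` is `Γ_ℚ`-stable),
  `eq_bot_or_eq_ker_or_eq_geomTorsion_of_cmRamified` (THE TRICHOTOMY).

The machine-currency form and the joint surjectivity of the Kolyvagin evaluations are the sequel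
`…BorelGrossSurjectivityLeaf` (file 8c). THEOREMS ONLY; no definition, no named fact, no `sorry`.
BSD is not proved by any of this; no summit statement is proved by this seat.
References: [Rubin1999] Prop. 5.4, Cor. 5.5; [GrossLMS1991] §9.
-/

set_option autoImplicit false
-- `…BirchSwinnertonDyer.BirchSwinnertonDyer.Theorems…` is the problem's mandated namespace (D-0017).
set_option linter.dupNamespace false

noncomputable section

open scoped Classical

namespace Summit.BirchSwinnertonDyer.BirchSwinnertonDyer.Theorems.PrintCFram.BorelKolyvaginPairing

open WeierstrassCurve Field Literature.NumberTheory.EllipticCurves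
  Literature.NumberTheory.EllipticCurves.KolyvaginPairing Literature.NumberTheory.GaloisRepresentations
  Literature.NumberTheory.EllipticCurves.Rank1Residual
  Summit.BirchSwinnertonDyer.BirchSwinnertonDyer.Theorems.PrintCFram.BorelHomothety
  Summit.BirchSwinnertonDyer.BirchSwinnertonDyer.Theorems.PrintCFram.BorelNonScalar

/-! ## §1 Generic: the three hypotheses of the uniserial Prop. 9.3 from a non-scalar commuting operator -/

section Generic

variable {A : Type*} [AddCommGroup A] (μ : A →+ A) {m : ℤ} {p : ℕ}

omit μ in
/-- `m • P = 0` for `P ∈ A[p]` and `|m| = p`. [folklore] -/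
theorem zsmul_eq_zero_of_natAbs_eq {P : A} (hP : P ∈ AddSubgroup.torsionBy A (p : ℤ))
    (hm : m.natAbs = p) : m • P = 0 := by
  have hp : (p : ℤ) • P = 0 := hP
  rcases Int.natAbs_eq m with h | h
  · rw [h, hm, hp]
  · rw [h, hm, neg_smul, hp, neg_zero]

/-- **Any vector off the line generates.** If `A[p] = ℤv + ℤμv` (`exists_generator_pair`) then for
every `P ∈ A[p]` with `μ P ≠ 0` also `A[p] = ℤP + ℤμP`: writing `P = a v + b μv` one has
`μP = a μv`, so `p ∤ a`, and `v`, `μv` are recovered from `P`, `μP` with an inverse of `a` modulo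
`p`. [cite: Rubin1999, Prop. 5.4 (E[𝔭] free of rank one over 𝒪/𝔭)] -/
theorem exists_eq_zsmul_add_zsmul_of_apply_ne_zero (hμμ : ∀ P, μ (μ P) = m • P)
    (hm : m.natAbs = p) (hp : p.Prime) {v : A} (hv : v ∈ AddSubgroup.torsionBy A (p : ℤ))
    (hgen : ∀ Q ∈ AddSubgroup.torsionBy A (p : ℤ), ∃ a b : ℤ, Q = a • v + b • μ v)
    {P : A} (hP : P ∈ AddSubgroup.torsionBy A (p : ℤ)) (hμP : μ P ≠ 0) :
    ∀ Q ∈ AddSubgroup.torsionBy A (p : ℤ), ∃ a b : ℤ, Q = a • P + b • μ P := by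
  have hp' : _root_.Prime (p : ℤ) := Nat.prime_iff_prime_int.mp hp
  obtain ⟨a, b, hab⟩ := hgen P hP
  have hmv : m • v = 0 := zsmul_eq_zero_of_natAbs_eq hv hm
  have hpμv : (p : ℤ) • μ v = 0 := by rw [← map_zsmul, (show (p : ℤ) • v = 0 from hv), map_zero]
  have hμP' : μ P = a • μ v := by
    rw [hab, map_add, map_zsmul, map_zsmul, hμμ, hmv, smul_zero, add_zero]
  -- `p ∤ a`
  have ha : ¬ (p : ℤ) ∣ a := by
    rintro ⟨c, rfl⟩
    exact hμP (by rw [hμP', mul_comm, mul_smul, hpμv, smul_zero])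
  obtain ⟨k, a', hk⟩ := (Prime.coprime_iff_not_dvd hp').mpr ha
  -- `μ v = a' μ P`, `v = a' P - a' b a' μ P`
  have hμv : μ v = a' • μ P := by
    rw [hμP', smul_smul]
    have : a' * a = 1 - k * p := by linarith [hk]
    rw [this, sub_smul, one_smul, mul_smul, hpμv, smul_zero, sub_zero]
  have hpP : (p : ℤ) • P = 0 := hP
  have hv' : v = a' • P - (a' * b * a') • μ P := by
    have h1 : a' • P = (a' * a) • v + (a' * b) • μ v := by rw [hab, smul_add, smul_smul, smul_smul]
    have : a' * a = 1 - k * p := by linarith [hk]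
    rw [this, sub_smul, one_smul, mul_smul, (show (p : ℤ) • v = 0 from hv), smul_zero, sub_zero] at h1
    rw [h1, hμv, smul_smul, mul_smul (a' * b) a', ← smul_smul, add_sub_cancel_right]
  intro Q hQ
  obtain ⟨a₁, b₁, rfl⟩ := hgen Q hQ
  refine ⟨a₁ * a', b₁ * a' - a₁ * (a' * b * a'), ?_⟩
  rw [hμv, hv']
  module

/-- **The trichotomy.** `μ² = m`, `|m| = p` prime, `#A[p] = p²`, `μ ≠ 0` on `A[p]`, and an additive
`f` acting on `A[p]` as `u + w μ` with `p ∤ w` (a NON-SCALAR operator commuting with `μ`). Then every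
`f`-stable subgroup `H ≤ A[p]` is `⊥`, `ker μ` (the line `μ(A[p])`, of order `p`) or `A[p]`:
if `H` has a vector `P` off the line then `w μP = fP − uP ∈ H`, so `μP ∈ H` and `H ⊇ ℤP + ℤμP = A[p]`;
otherwise `H ≤ ker μ`, of prime order. [cite: Rubin1999, Prop. 5.4] -/
theorem eq_bot_or_eq_ker_or_eq_torsionBy (hμμ : ∀ P, μ (μ P) = m • P) (hm : m.natAbs = p)
    (hp : p.Prime) (hcard : Nat.card (AddSubgroup.torsionBy A (p : ℤ)) = p ^ 2)
    (hne : ∃ P ∈ AddSubgroup.torsionBy A (p : ℤ), μ P ≠ 0)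
    (f : A →+ A) {u w : ℤ} (hf : ∀ P ∈ AddSubgroup.torsionBy A (p : ℤ), f P = u • P + w • μ P)
    (hw : ¬ (p : ℤ) ∣ w) {H : AddSubgroup A} (hHp : H ≤ AddSubgroup.torsionBy A (p : ℤ))
    (hH : ∀ P ∈ H, f P ∈ H) :
    H = ⊥ ∨ H = μ.ker ∨ H = AddSubgroup.torsionBy A (p : ℤ) := by
  have hp' : _root_.Prime (p : ℤ) := Nat.prime_iff_prime_int.mp hp
  by_cases h : ∃ P ∈ H, μ P ≠ 0
  · -- a vector off the line: `H = A[p]`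
    obtain ⟨P, hPH, hμP⟩ := h
    right; right
    have hP : P ∈ AddSubgroup.torsionBy A (p : ℤ) := hHp hPH
    have hpμP : (p : ℤ) • μ P = 0 := by rw [← map_zsmul, (show (p : ℤ) • P = 0 from hP), map_zero]
    have hwμ : w • μ P ∈ H := by
      have h1 := H.sub_mem (hH P hPH) (H.zsmul_mem hPH u)
      rwa [hf P hP, add_sub_cancel_left] at h1
    have hμPH : μ P ∈ H := by
      obtain ⟨k, w', hk⟩ := (Prime.coprime_iff_not_dvd hp').mpr hw
      have : μ P = w' • (w • μ P) + k • ((p : ℤ) • μ P) := by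
        rw [smul_smul, smul_smul, ← add_smul, add_comm, hk, one_smul]
      rw [this, hpμP, smul_zero, add_zero]
      exact H.zsmul_mem hwμ w'
    obtain ⟨v, hv, hgen⟩ := exists_generator_pair μ hμμ hm hp hcard hne (M := 1) le_rfl
      (by simpa using hcard)
    simp only [pow_one] at hv hgen
    have hgenP := exists_eq_zsmul_add_zsmul_of_apply_ne_zero μ hμμ hm hp hv hgen hP hμP
    refine le_antisymm hHp fun Q hQ => ?_
    obtain ⟨a, b, rfl⟩ := hgenP Q hQ
    exact H.add_mem (H.zsmul_mem hPH a) (H.zsmul_mem hμPH b)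
  · -- `H ≤ ker μ`, a group of prime order
    push Not at h
    have hle : H ≤ μ.ker := fun P hP => (AddMonoidHom.mem_ker).mpr (h P hP)
    have hker : Nat.card μ.ker = p := natCard_ker_eq μ hμμ hm hp hcard hne
    haveI : Finite μ.ker := Nat.finite_of_card_ne_zero (by rw [hker]; exact hp.ne_zero)
    have hdvd : Nat.card H ∣ p := hker ▸ AddSubgroup.card_dvd_of_le hle
    rcases (Nat.dvd_prime hp).mp hdvd with h1 | hpH
    · exact Or.inl (AddSubgroup.eq_bot_of_card_eq H h1)
    · exact Or.inr (Or.inl (AddSubgroup.eq_of_le_of_card_ge hle (by rw [hker, hpH])))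

/-- **The quotient by the line is cyclic**: with `v` as in `exists_generator_pair`, every `P ∈ A[p]`
is `≡ a v (mod ker μ)` (`P = a v + b μv` and `μ(μ v) = m v = 0`). [cite: Rubin1999, Prop. 5.4] -/
theorem exists_sub_zsmul_mem_ker (hμμ : ∀ P, μ (μ P) = m • P) (hm : m.natAbs = p)
    {v : A} (hv : v ∈ AddSubgroup.torsionBy A (p : ℤ))
    (hgen : ∀ Q ∈ AddSubgroup.torsionBy A (p : ℤ), ∃ a b : ℤ, Q = a • v + b • μ v)
    {P : A} (hP : P ∈ AddSubgroup.torsionBy A (p : ℤ)) : ∃ a : ℤ, P - a • v ∈ μ.ker := by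
  obtain ⟨a, b, rfl⟩ := hgen P hP
  refine ⟨a, ?_⟩
  rw [add_sub_cancel_left, AddMonoidHom.mem_ker, map_zsmul, hμμ, zsmul_eq_zero_of_natAbs_eq hv hm,
    smul_zero]

/-- **Powers of `a + bμ`.** If `g` acts on `A[p]` as `a + b μ` (commuting with `μ`, `μ² = m ≡ 0`),
then `gⁿ` acts as `aⁿ + n aⁿ⁻¹ b μ`. [folklore] -/
theorem pow_smul_eq {G : Type*} [Group G] [DistribMulAction G A] (hμμ : ∀ P, μ (μ P) = m • P)
    (hm : m.natAbs = p) {g : G} (hg : ∀ P, μ (g • P) = g • μ P)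
    {a b : ℤ} (hab : ∀ P ∈ AddSubgroup.torsionBy A (p : ℤ), g • P = a • P + b • μ P) (n : ℕ) :
    ∀ P ∈ AddSubgroup.torsionBy A (p : ℤ),
      g ^ n • P = (a ^ n) • P + ((n : ℤ) * a ^ (n - 1) * b) • μ P := by
  induction n with
  | zero => intro P _; simp
  | succ n ih =>
    intro P hP
    rw [pow_succ', mul_smul, ih P hP, smul_add, smul_comm g (a ^ n) P,
      smul_comm g ((n : ℤ) * a ^ (n - 1) * b) (μ P), ← hg, hab P hP, map_add, map_zsmul, map_zsmul,
      hμμ, zsmul_eq_zero_of_natAbs_eq hP hm, smul_zero, add_zero, smul_add, smul_smul, smul_smul,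
      smul_smul]
    rcases Nat.eq_zero_or_pos n with rfl | hn
    · simp
    · obtain ⟨k, rfl⟩ := Nat.exists_eq_add_of_le' hn
      simp only [Nat.add_sub_cancel, pow_succ, Nat.cast_add, Nat.cast_one]
      rw [add_assoc, ← add_smul]
      congr 2
      ring

end Generic

/-! ## §2 The leaf, `ℚ̄`-side: every `Γ_{K''}`-stable subgroup of `W[p]` is `0`, `W[𝔭]` or `W[p]` -/

section Leaf

variable (W : WeierstrassCurve ℚ) [W.IsElliptic] (p : ℕ) [hp : Fact p.Prime]

/-- **A non-scalar element `u + wμ`, `p ∤ w`, in `res(Γ_{K''})` for every number field `K''` of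
degree `< p`.** For `W` CM, `p ≥ 5` CM-ramified, `μ = √−p ∈ End W(ℚ̄)` with its Galois sign rule
(`exists_sqrt_end_of_cmRamified`) and `[K'' : ℚ] < p`: some `g ∈ Γ_{K''}` acts on `W[p]` as
`u + w μ` with `p ∤ w`. It is a power `σⁿ`, `0 < n ≤ [K'' : ℚ]`, of the non-scalar `σ` fixing `√−p`
of `BorelNonScalar.exists_frobenius_nonScalar_of_cmRamified` (w4 g3): `σ = a + bμ` with `p ∤ ab`,
`σⁿ = aⁿ + n aⁿ⁻¹ b μ`. (Covers `K'' = ℚ(√−p)` itself and the biquadratic `K·K''`.)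
[cite: Rubin1999, Cor. 5.5] [cite: GrossLMS1991, §9] -/
theorem exists_restrict_smul_eq_nonScalar (hCM : W.HasCM) (h5 : 5 ≤ p) (hram : CMRamified W p)
    {s : AlgebraicClosure ℚ} {μ : AddMonoid.End W.geomPoints} {m : ℤ}
    (hs : s ^ 2 = ((-(p : ℤ) : ℤ) : AlgebraicClosure ℚ)) (hm : m.natAbs = p)
    (hμμ : ∀ P, μ (μ P) = m • P) (hcomm : ∀ g : absoluteGaloisGroup ℚ, g • s = s → ∀ P, μ (g • P) = g • μ P)
    (K : Type) [Field K] [NumberField K] (hK : Module.finrank ℚ K < p) :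
    ∃ (g : absoluteGaloisGroup K) (u w : ℤ), ¬ (p : ℤ) ∣ w ∧
      ∀ P ∈ W.geomTorsion (p : ℤ), absGaloisRestrict ℚ K g • P = u • P + w • μ P := by
  have hpr : p.Prime := hp.out
  have hp' : _root_.Prime (p : ℤ) := Nat.prime_iff_prime_int.mp hpr
  have hne := exists_mem_geomTorsion_apply_ne_zero W p hμμ hm
  obtain ⟨σ, hσs, hσ⟩ := exists_frobenius_nonScalar_of_cmRamified p W hCM h5 hram hs
  -- `σ = a + b μ` on `W[p]`
  obtain ⟨a, b, hab⟩ := smul_eq_smul_add_smul_of_comm W p hμμ hm hne (M := 1) le_rfl (hcomm σ hσs)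
  simp only [pow_one] at hab
  -- `p ∤ b`: otherwise `σ` is the scalar `a`
  have hb : ¬ (p : ℤ) ∣ b := by
    rintro ⟨c, rfl⟩
    obtain ⟨Q, hQ⟩ := hσ a
    apply hQ
    apply Subtype.ext
    have hpμQ : (p : ℤ) • μ (Q : W.geomPoints) = 0 := by
      rw [← map_zsmul, (show (p : ℤ) • (Q : W.geomPoints) = 0 from Q.2), map_zero]
    change σ • (Q : W.geomPoints) = ((a • Q : W.geomTorsion (p : ℤ)) : W.geomPoints)
    rw [AddSubgroupClass.coe_zsmul, hab Q Q.2, mul_comm, mul_smul, hpμQ, smul_zero, add_zero]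
  -- `p ∤ a`: otherwise `σ` kills `μ P₀ ≠ 0`
  have ha : ¬ (p : ℤ) ∣ a := by
    rintro ⟨c, rfl⟩
    obtain ⟨P₀, hP₀, hμP₀⟩ := hne
    have hμP₀T : μ P₀ ∈ W.geomTorsion (p : ℤ) := apply_mem_torsionBy (μ : W.geomPoints →+ W.geomPoints) hP₀
    have hpμ : (p : ℤ) • μ P₀ = 0 := hμP₀T
    have h0 : σ • μ P₀ = 0 := by
      rw [hab _ hμP₀T, mul_comm, mul_smul, hpμ, smul_zero, zero_add,
        (show μ (μ P₀) = m • P₀ from hμμ P₀), zsmul_eq_zero_of_natAbs_eq hP₀ hm, smul_zero]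
    exact hμP₀ ((smul_eq_zero_iff_eq σ).mp h0)
  -- `σⁿ ∈ res(Γ_K)` with `0 < n ≤ [K : ℚ] < p`
  have hidx : (absGaloisRestrict ℚ K).range.index = Module.finrank ℚ K :=
    index_range_absGaloisRestrict_eq_finrank ℚ K
  obtain ⟨n, hn0, hnle, hmem⟩ := Subgroup.exists_pow_mem_of_index_ne_zero
    (H := (absGaloisRestrict ℚ K).range) (by rw [hidx]; exact Module.finrank_pos.ne') σ
  rw [hidx] at hnle
  obtain ⟨g, hg⟩ := hmem
  change absGaloisRestrict ℚ K g = σ ^ n at hg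
  refine ⟨g, a ^ n, (n : ℤ) * a ^ (n - 1) * b, fun hdvd => ?_, fun P hP => ?_⟩
  · -- `p ∣ n aⁿ⁻¹ b` is impossible
    rcases hp'.dvd_or_dvd hdvd with h | h
    · rcases hp'.dvd_or_dvd h with h | h
      · have : p ∣ n := by exact_mod_cast h
        exact absurd (Nat.le_of_dvd hn0 this) (by omega)
      · exact ha (hp'.dvd_of_dvd_pow h)
    · exact hb h
  · rw [hg]
    exact pow_smul_eq (μ : W.geomPoints →+ W.geomPoints) hμμ hm (hcomm σ hσs) hab n P hP

omit [W.IsElliptic] hp in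
/-- **`W[𝔭] = ker μ` is `Γ_ℚ`-stable** (every `g` fixes or negates `√−p`, and `μ ∘ g = ± g ∘ μ`).
[cite: Rubin1999, Cor. 5.5] -/
theorem smul_mem_ker_of_mem_ker {s : AlgebraicClosure ℚ} {μ : AddMonoid.End W.geomPoints}
    (hs : s ^ 2 = ((-(p : ℤ) : ℤ) : AlgebraicClosure ℚ))
    (hcomm : ∀ g : absoluteGaloisGroup ℚ, g • s = s → ∀ P, μ (g • P) = g • μ P)
    (hanti : ∀ g : absoluteGaloisGroup ℚ, g • s = -s → ∀ P, μ (g • P) = -(g • μ P))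
    (g : absoluteGaloisGroup ℚ) {P : W.geomPoints} (hP : P ∈ (μ : W.geomPoints →+ W.geomPoints).ker) :
    g • P ∈ (μ : W.geomPoints →+ W.geomPoints).ker := by
  rw [AddMonoidHom.mem_ker] at hP ⊢
  have hs' : s ^ 2 = algebraMap ℚ (AlgebraicClosure ℚ) (-(p : ℚ)) := by rw [hs]; push_cast; rfl
  rcases smul_eq_or_eq_neg p ℚ hs' g with h | h
  · change μ (g • P) = 0
    rw [hcomm g h, (show μ P = 0 from hP), smul_zero]
  · change μ (g • P) = 0
    rw [hanti g h, (show μ P = 0 from hP), smul_zero, neg_zero]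

/-- **The trichotomy on the leaf (`ℚ̄`-side).** For `W/ℚ` with CM, `p ≥ 5` CM-ramified, `μ = √−p`
with its sign rule, and any number field `K''` with `[K'' : ℚ] < p`: a subgroup `H ≤ W[p]` of
`W(ℚ̄)` stable under `res(Γ_{K''})` is `0`, `ker μ = W[𝔭]` or `W[p]`. In particular `W[𝔭]` is the
UNIQUE `Γ_{K''}`-stable line and `W[p]` is a non-split (uniserial) `Γ_{K''}`-module — even over
`K'' = ℚ(√−p)`. [cite: Rubin1999, Cor. 5.5] [cite: GrossLMS1991, Prop. 9.3] -/
theorem eq_bot_or_eq_ker_or_eq_geomTorsion_of_cmRamified (hCM : W.HasCM) (h5 : 5 ≤ p)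
    (hram : CMRamified W p) {s : AlgebraicClosure ℚ} {μ : AddMonoid.End W.geomPoints} {m : ℤ}
    (hs : s ^ 2 = ((-(p : ℤ) : ℤ) : AlgebraicClosure ℚ)) (hm : m.natAbs = p)
    (hμμ : ∀ P, μ (μ P) = m • P) (hcomm : ∀ g : absoluteGaloisGroup ℚ, g • s = s → ∀ P, μ (g • P) = g • μ P)
    (K : Type) [Field K] [NumberField K] (hK : Module.finrank ℚ K < p)
    {H : AddSubgroup W.geomPoints} (hHp : H ≤ W.geomTorsion (p : ℤ))
    (hH : ∀ g : absoluteGaloisGroup K, ∀ P ∈ H, absGaloisRestrict ℚ K g • P ∈ H) :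
    H = ⊥ ∨ H = (μ : W.geomPoints →+ W.geomPoints).ker ∨ H = W.geomTorsion (p : ℤ) := by
  obtain ⟨g, u, w, hw, hg⟩ := exists_restrict_smul_eq_nonScalar W p hCM h5 hram hs hm hμμ hcomm K hK
  exact eq_bot_or_eq_ker_or_eq_torsionBy (μ : W.geomPoints →+ W.geomPoints) hμμ hm hp.out
    (W.natCard_geomTorsion_prime_eq_sq hp.out) (exists_mem_geomTorsion_apply_ne_zero W p hμμ hm)
    (DistribSMul.toAddMonoidHom W.geomPoints (absGaloisRestrict ℚ K g)) (fun P hP => hg P hP) hw hHp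
    (fun P hP => hH g P hP)

end Leaf


end Summit.BirchSwinnertonDyer.BirchSwinnertonDyer.Theorems.PrintCFram.BorelKolyvaginPairing

end
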